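import Mathlib
import Summits.KontsevichZagierPeriods.Zeta5Search.WedgeDictionaryCells
import Summits.KontsevichZagierPeriods.Zeta5Search.WedgeDictionaryKernelCellStar
import Summits.KontsevichZagierPeriods.Zeta5Search.WedgeDictionaryKernelCellPencil
import Summits.KontsevichZagierPeriods.Zeta5Search.BarnesDouble
import Summits.KontsevichZagierPeriods.Zeta5Search.CellularCubicalSubstitution
import Summits.KontsevichZagierPeriods.Zeta5Search.InvarianceGroup
import HarnessLib

/-!
# The cellular STAR and PENCIL families are KERNEL THEOREMS; `explicitPQ` transports along every `σ ∈ Σ₇`;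
# the D2 end statement without hypotheses: `explicitPQ ↔ CellBridge ∧ three level-1 values` (cell `pub-zeta5`, ct-1 g17)

HONEST FRAMING: systematic search; no irrationality claim unless certified.  Identities among Brown–Zudilin's absolutely
convergent cellular integrals `I(a)` (arXiv:2210.03391, Sect. 1 (1), Sect. 5 (16), Sect. 7 (27)) and an equivalence between
DISPLAYED statements about gen-1's period dictionary (`WedgeDictionary.explicitPQ`, an OPEN `@[conjecture]` node); no integral is
evaluated, no linear form is bounded, nothing about ζ(5).

OUR work (Summit side; seat `pub-zeta5-ct-1` g17, 2026-08-25).  The gen-1 lineage derived the two cellular three-term relation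
families of `WedgeDictionaryThreeTerm` from four published inputs taken as HYPOTHESES — F1a `cellularIntegral_eq_cubicalIntegral`
((1) = (8)), F1b `cubicalIntegral_eq_Jintegral` ((8) = (10)), F2 `barnes_double` ((16)), F3 `invariance_group` ((27) for all of
`G ≅ Σ₇`): `KernelCells.cellStar_of_F123`, `KernelCells.cellPencil_of_F123` (gen-1 g21, 93 files of kernel certificates, transports
and atlas dispatchers).  All four inputs are now tree theorems — `CellularCubicalSubstitution.cellularIntegral_eq_cubicalIntegral_holds`,
`CubicalSubstitution.cubicalIntegral_eq_Jintegral_holds` (P2), `BarnesDouble.barnes_double_holds` (ct-1 g11),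
`InvarianceGroup.invariance_group_holds` (ct-1 g15) — so:

* **`cellStar_holds : CellStar`**, **`cellPencil_holds : CellPencil`** — the two `@[conjecture]`-tagged cellular nodes (all 42 ordered
  slot pairs / all 7 slots, every admissible parameter) are hypothesis-free kernel theorems.
* **`explicitPQAt_slotPerm`** — `explicitPQ` at a region point `a` gives `explicitPQ` at `σ·a` for EVERY `σ ∈ Σ₇` with `σ·a` in the
  region, directly (gen-1's `explicitPQAt_transport` fed with `invariance_group_holds` and `b(σ·a) = σ⁻¹ ∘ b(a)`, `bOfA_slotPerm`);
  previously only along the five generators and modulo `(hInv : invariance_of_converges')`, so that two region points in one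
  `Σ₇`-orbit were linked only through chains of CONVERGENT intermediate points.  At level `b₀ = 1` the six two-slot region points
  (the non-edge pairs `16, 46 | 17, 45, 35, 27`) form TWO classes under generator chains but ONE `Σ₇`-orbit: `D16_of_D17`.
* **`explicitPQ_iff_bridge_data3`** — the D2 END STATEMENT of `WedgeDictionaryCells` (`Rows.explicitPQ_iff_cells4 (hInv)`:
  `explicitPQ ↔ CellStar ∧ CellPencil ∧ CellBridge ∧ D1 ∧ D2 ∧ D16 ∧ D17`) with STAR, PENCIL, the invariance hypothesis and `D16`
  DISCHARGED: **`explicitPQ ↔ CellBridge ∧ D1 ∧ D2 ∧ D17`**, hypothesis-free, where `D1, D2, D17` are `ExplicitPQAt` at the level-1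
  points `(1,0,1,0,1,1,1,1; 1)`, `(0,0,1,0,1,1,1,1; 2)`, `(0,0,1,0,1,1,0,1; 2)` — one per `Σ₇`-orbit type of level-1 region points
  (`|{i : b_i = 1}| = 0, 1, 2`); the same for the wedge-square dictionary `wedgeDictionary` (`wedgeDictionary_iff_bridge_data3`).

What this file is NOT: a proof of `CellBridge` (gen-1 g22: the native kernel certificate `KernelCells.cellBridge_native` needs a common
chamber, which 251 of the 349 consumption sites of the Rows certificates do not have), of any of the three values (period computations),
or of `explicitPQ`; nothing analytic is added here (assembly only); nothing about irrationality.
-/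

noncomputable section

open Finset

namespace Summit.KontsevichZagierPeriods.Zeta5Search.CellStarPencilDischarge

open Summit.KontsevichZagierPeriods.Zeta5Search.WedgeDictionary
open Summit.KontsevichZagierPeriods.Zeta5Search.WedgeDictionary.KernelCells (cellStar_of_F123 cellPencil_of_F123)
open Summit.KontsevichZagierPeriods.Zeta5Search.CellularCubicalSubstitution (cellularIntegral_eq_cubicalIntegral_holds)
open Summit.KontsevichZagierPeriods.Zeta5Search.CubicalSubstitution (cubicalIntegral_eq_Jintegral_holds)
open Summit.KontsevichZagierPeriods.Zeta5Search.BarnesDouble (barnes_double_holds)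
open Summit.KontsevichZagierPeriods.Zeta5Search.InvarianceGroup (invariance_group_holds)
open Summit.KontsevichZagierPeriods.Zeta5Search.InvarianceOfConverges (invariance_of_converges'_holds)
open Summit.KontsevichZagierPeriods.Zeta5Search.AmpleGroupInvariance (slotPerm_def bOfA_aOfB permB)
open Summit.KontsevichZagierPeriods.Zeta5Search.SymmetricGauge (permLower permLower_apply_of_not)
open Literature.NumberTheory.Irrationality.BrownZudilin2022

/-! ## 1. The two cellular relation families, hypothesis-free -/

/-- **The cellular STAR family holds**: for every admissible `a` and every ordered slot pair `i ≠ k`,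
`κ·I(a) − χ_kΠ_k·I(a − s_k) + χ_iΠ_i·I(a − s_i) = 0` (the `@[conjecture]` node `WedgeDictionary.CellStar`), from gen-1's
`cellStar_of_F123` and the four tree theorems F1a, F1b, F2, F3. -/
theorem cellStar_holds : CellStar :=
  cellStar_of_F123 cellularIntegral_eq_cubicalIntegral_holds cubicalIntegral_eq_Jintegral_holds barnes_double_holds
    invariance_group_holds

/-- **The cellular PENCIL family holds**: for every admissible `a` and every slot `i`,
`−P₂P₃·I(a) + P_i(P₀+1−P_i)·I(a + DS) + χ_iΠ_i·I(a + DS − s_i) = 0` (the `@[conjecture]` node `WedgeDictionary.CellPencil`),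
from gen-1's `cellPencil_of_F123` and the four tree theorems F1a, F1b, F2, F3. -/
theorem cellPencil_holds : CellPencil :=
  cellPencil_of_F123 cellularIntegral_eq_cubicalIntegral_holds cubicalIntegral_eq_Jintegral_holds barnes_double_holds
    invariance_group_holds

/-! ## 2. Transport of `explicitPQ` along every `σ ∈ Σ₇` -/

/-- `b(σ·a) = b(a) ∘ σ⁻¹` on the dual slots: `bOfA (slotPerm σ a) = permLower σ⁻¹ (bOfA a)` (both read `b₀` unchanged,
`b_j = b_{σ⁻¹ j}` for `1 ≤ j ≤ 7`, and `0` beyond). -/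
theorem bOfA_slotPerm (σ : Equiv.Perm (Fin 7)) (a : Fin 8 → ℤ) :
    bOfA (slotPerm σ a) = permLower σ⁻¹ (bOfA a) := by
  funext j
  by_cases hj : j ≤ 7
  · rw [slotPerm_def, bOfA_aOfB _ _ hj]
    unfold permB permLower
    split_ifs with h1 <;> rfl
  · obtain ⟨k, rfl⟩ : ∃ k, j = k + 8 := ⟨j - 8, by omega⟩
    rw [permLower_apply_of_not _ _ (by omega)]
    rfl

/-- The hypotheses of `explicitPQ` transport along `σ`: partner `j = σ⁻¹(i)+1` at `a` becomes partner `i+1` at `σ·a`,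
given convergence of `σ·a`. -/
theorem regionHyp_slotPerm (σ : Equiv.Perm (Fin 7)) {a : Fin 8 → ℤ} (i : Fin 7) {j : ℕ}
    (hj : j = (σ⁻¹ i).val + 1) (hr : RegionHyp a j) (hc : Converges (slotPerm σ a)) :
    RegionHyp (slotPerm σ a) (i.val + 1) :=
  regionHyp_transport (g := slotPerm σ) (σ := σ⁻¹) (bOfA_slotPerm σ a) hc i hj hr

/-- **`explicitPQ` transports along every `σ ∈ Σ₇`** (hypothesis-free): `ExplicitPQAt a (σ⁻¹(i)+1) → ExplicitPQAt (σ·a) (i+1)`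
for a region point `a` with `σ·a` convergent — gen-1's `explicitPQAt_transport` with (27) supplied by `invariance_group_holds`. -/
theorem explicitPQAt_slotPerm (σ : Equiv.Perm (Fin 7)) {a : Fin 8 → ℤ} (i : Fin 7) {j : ℕ}
    (hj : j = (σ⁻¹ i).val + 1) (hr : RegionHyp a j) (hc : Converges (slotPerm σ a)) (h : ExplicitPQAt a j) :
    ExplicitPQAt (slotPerm σ a) (i.val + 1) :=
  explicitPQAt_transport (g := slotPerm σ) (σ := σ⁻¹) (bOfA_slotPerm σ a) (invariance_group_holds σ a hr.2.1 hc) i hj hr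
    (regionHyp_slotPerm σ i hj hr hc) h

/-- **Any-partner form**: `explicitPQ` at a region point `a` (partner `j`) gives `explicitPQ` at `σ·a` for any admissible
partner `j'` there. -/
theorem explicitPQAt_slotPerm' (σ : Equiv.Perm (Fin 7)) {a : Fin 8 → ℤ} {j j' : ℕ}
    (hr : RegionHyp a j) (hr' : RegionHyp (slotPerm σ a) j') (h : ExplicitPQAt a j) :
    ExplicitPQAt (slotPerm σ a) j' := by
  have hjI := hr.1
  simp only [mem_Icc] at hjI
  set i₀ : Fin 7 := ⟨j - 1, by omega⟩ with hi₀
  have hσ : σ⁻¹ (σ i₀) = i₀ := σ.symm_apply_apply i₀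
  have hj : j = (σ⁻¹ (σ i₀)).val + 1 := by
    rw [hσ]
    simp only [hi₀]
    omega
  exact explicitPQAt_partner (regionHyp_slotPerm σ (σ i₀) hj hr hr'.2.1) hr' (explicitPQAt_slotPerm σ (σ i₀) hj hr hr'.2.1 h)

/-- **One point per orbit**: at two region points in the same `Σ₇`-orbit, `explicitPQ` holds at one iff at the other. -/
theorem explicitPQAt_slotPerm_iff (σ : Equiv.Perm (Fin 7)) {a : Fin 8 → ℤ} {j j' : ℕ}
    (hr : RegionHyp a j) (hr' : RegionHyp (slotPerm σ a) j') :
    ExplicitPQAt a j ↔ ExplicitPQAt (slotPerm σ a) j' := by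
  refine ⟨explicitPQAt_slotPerm' σ hr hr', fun h => ?_⟩
  have e : slotPerm σ⁻¹ (slotPerm σ a) = a := by
    rw [← AmpleGroupInvariance.slotPerm_mul, inv_mul_cancel, AmpleGroupInvariance.slotPerm_one]
  have t := explicitPQAt_slotPerm' σ⁻¹ hr' (by rw [e]; exact hr) h
  rw [e] at t
  exact t

/-! ## 3. Level 1: the ghost-pair value `D16` from the top-pair value `D17` by `σ = (67)` -/

/-- `(67)·(0,0,1,0,1,1,0,1) = (0,0,1,0,1,0,0,1)`: the level-1 top pair `{1,7}` goes to the ghost pair `{1,6}`. -/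
theorem slotPerm_swap67_D17 : slotPerm (Equiv.swap (5 : Fin 7) 6) ![0,0,1,0,1,1,0,1] = ![0,0,1,0,1,0,0,1] := by
  decide

/-- **`D16` from `D17`**: `ExplicitPQAt (0,0,1,0,1,1,0,1) 2 → ExplicitPQAt (0,0,1,0,1,0,0,1) 2` — the two level-1 values of gen-1's
data that its generator chains could not link (the intermediate points diverge) lie in one `Σ₇`-orbit. -/
theorem D16_of_D17 (D17 : ExplicitPQAt ![0,0,1,0,1,1,0,1] 2) : ExplicitPQAt ![0,0,1,0,1,0,0,1] 2 := by
  have t := explicitPQAt_slotPerm' (Equiv.swap (5 : Fin 7) 6) (a := ![0,0,1,0,1,1,0,1]) (j := 2) (j' := 2)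
    (by unfold RegionHyp; decide) (by rw [slotPerm_swap67_D17]; unfold RegionHyp; decide) D17
  rw [slotPerm_swap67_D17] at t
  exact t

/-! ## 4. The D2 end statement, hypothesis-free -/

/-- **`explicitPQ` from the cellular BRIDGE family and THREE level-1 values** (STAR, PENCIL, both dictionary nodes, the
invariance (27) and `D16` discharged by tree theorems). -/
theorem explicitPQ_of_bridge_data3 (hcB : CellBridge) (D1 : ExplicitPQAt ![1,0,1,0,1,1,1,1] 1)
    (D2 : ExplicitPQAt ![0,0,1,0,1,1,1,1] 2) (D17 : ExplicitPQAt ![0,0,1,0,1,1,0,1] 2) : explicitPQ :=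
  Rows.explicitPQ_of_cells4 cellStar_holds cellPencil_holds hcB invariance_of_converges'_holds D1 D2 (D16_of_D17 D17) D17

/-- **The D2 end statement without hypotheses.**  gen-1's wedge conjecture `explicitPQ` is EQUIVALENT to the conjunction of the
cellular BRIDGE family `CellBridge` and its three level-1 instances at `(1,0,1,0,1,1,1,1; 1)`, `(0,0,1,0,1,1,1,1; 2)`,
`(0,0,1,0,1,1,0,1; 2)` (one per `Σ₇`-orbit type `|{i : b_i = 1}| = 0, 1, 2` of level-1 region points). -/
theorem explicitPQ_iff_bridge_data3 :
    explicitPQ ↔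
      (CellBridge ∧ ExplicitPQAt ![1,0,1,0,1,1,1,1] 1 ∧ ExplicitPQAt ![0,0,1,0,1,1,1,1] 2 ∧ ExplicitPQAt ![0,0,1,0,1,1,0,1] 2) := by
  refine ⟨fun h => ?_, fun h => explicitPQ_of_bridge_data3 h.1 h.2.1 h.2.2.1 h.2.2.2⟩
  have h4 := (Rows.explicitPQ_iff_cells4 invariance_of_converges'_holds).1 h
  exact ⟨h4.2.2.1, h4.2.2.2.1, h4.2.2.2.2.1, h4.2.2.2.2.2.2⟩

/-- **The same for gen-1's wedge-square dictionary** `WedgeDictionary.wedgeDictionary` (the cell's period dictionary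
`I(a) = 2ρ·[(W(b′) − 2ζ(2)U(b′))·F̃₇(b) − (W(b) − 2ζ(2)U(b))·F̃₇(b′)]`, equivalent to `explicitPQ` by the tree's
`wedgeDictionary_iff_explicitPQ`): it is EQUIVALENT to `CellBridge` plus the same three level-1 values. -/
theorem wedgeDictionary_iff_bridge_data3 :
    wedgeDictionary ↔
      (CellBridge ∧ ExplicitPQAt ![1,0,1,0,1,1,1,1] 1 ∧ ExplicitPQAt ![0,0,1,0,1,1,1,1] 2 ∧ ExplicitPQAt ![0,0,1,0,1,1,0,1] 2) :=
  wedgeDictionary_iff_explicitPQ.trans explicitPQ_iff_bridge_data3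

end Summit.KontsevichZagierPeriods.Zeta5Search.CellStarPencilDischarge

end
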